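import Literature.IUT.HodgeTheaters.LocalFrobenioidsArchModel
import Literature.IUT.HodgeTheaters.SplitTopMonoidHomNonVacuity
import HarnessLib

/-!
# [IUTchI] Cor 5.3 (iii) — the ARCHIMEDEAN `⊢`-slot, PRINT-FAITHFUL at the GENUINE carrier: an `ℱ⊢`-datum at `v ∈ 𝕍^arc` is a TRIPLE
# `(‡𝒞⊢_v, ‡M ∈ 𝕋𝕄⊢, ‡τ⊢_v)` isomorphic to the model, its `𝒟⊢`-constituent is `‡M`, and «`Isom(¹𝔉⊢, ²𝔉⊢) → Isom(¹𝔇⊢, ²𝔇⊢)` is surjective»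
# there says: every `𝕋𝕄⊢`-isomorphism `¹M ⥲ ²M` extends to an isomorphism of triples (abc-iut-L5-t4, row R83 (2a) «COR53III-ARCH-SLOT
# PRINT-FAITHFUL»; the [AbsTopIII] Rmk 5.8.1 (i) DILATION LIFT is row R84, NOT claimed here)

S. Mochizuki, *Inter-universal Teichmüller theory I*, kurims manuscript (May 2020), §5 Definition 5.2 (ii) p. 134: «(b) if `v ∈ 𝕍^arc`, then
`‡ℱ⊢_v` is a triple of data, consisting of a Frobenioid `‡𝒞⊢_v`, an object of `𝕋𝕄⊢`, and a splitting of the Frobenioid, such that there exists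
an isomorphism of collections of data `‡ℱ⊢_v ⥲ ℱ⊢_v`»; Definition 5.2 (iii) p. 134: «A morphism of `ℱ⊢`-prime-strips is defined to be a
collection of isomorphisms, indexed by `𝕍`, between the various constituent objects of the prime-strips»; §4 Definition 4.1 (iii) p. 96:
«(b) if `v ∈ 𝕍^arc`, then `†𝒟⊢_v` is an object of the category `𝕋𝕄⊢`»; §3 Example 3.4 (ii) p. 81: «we may think of the pair
`(𝒪^▷(𝒞⊢_v), τ⊢_v)` as the object of `𝕋𝕄⊢` determined by `K_v`», «the object `(𝒪^▷(𝒞⊢_v), τ⊢_v)` of `𝕋𝕄⊢` is isomorphic to `𝒟⊢_v`» (Cor 3.9 (ii):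
not canonically); §5 Corollary 5.3 (iii) p. 144 l. 16–19: «For `i = 1, 2`, let `ⁱ𝔉⊢` be an `ℱ⊢`-prime-strip; `ⁱ𝔇⊢` the `𝒟⊢`-prime-strip
associated to `ⁱ𝔉⊢` [cf. Remark 5.2.1, (i)]. Then the natural map `Isom(¹𝔉⊢, ²𝔉⊢) → Isom(¹𝔇⊢, ²𝔇⊢)` [cf. Remark 5.2.1, (i)] is surjective»;
proof p. 144 l. 33–36: «follows immediately from […] [AbsTopIII], Proposition 5.8, (ii), (v)» ([IUTchI] Cor 5.3 (iii) p.144)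
[claim: Mochizuki2012, status: disputed] (D-0012 claim key, series status DISPUTED — a TYPING of print's own sentences over abc-iut's GENUINE
archimedean carrier plus elementary proofs; nothing of the series is asserted; no side is taken on [IUTchIII] Cor. 3.12).

## What this file types and proves (cell abc-iut, L5 HUB node `IUTchI:Cor5.3(iii)`, ARCH `⊢`-SLOT of the telescope of record; abc-iut-L5-lead
## RULINGS #151 (2a); def-light: 2 structures + 2 defs; 0 instance · 0 notation · no `Prop` fact)

At `v ∈ 𝕍^arc` print attaches NO datum linking `‡𝒞⊢_v` to the `𝕋𝕄⊢`-object (contrast Def 5.2 (i)(b), where the Kummer structure `‡κ_v` does), and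
the `𝒟⊢`-prime-strip constituent at `v` IS the `𝕋𝕄⊢`-object (Def 4.1 (iii)(b), Rmk 5.2.1 (i)).  So, READ ON THE PAGE, the «natural map» of (iii) at an
archimedean index is the COMPONENT PROJECTION, and its surjectivity has exactly the content «`Isom_{τ⊢}(¹𝒞⊢_v, ²𝒞⊢_v) ≠ ∅`», immediate from the
model-isomorphism clause of Def 5.2 (ii)(b).  This file types that VERBATIM over the GENUINE carrier and proves it:
* `ArchDashTriple C O^▷` — objects = triples `(C, (O^▷, τ), M)`: a category `C` (= `‡𝒞⊢_v`), a topological monoid `O^▷` (parameters) with a splitting submonoid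
  `τ` (= `‡τ⊢_v`, the [FrdII] Ex 3.3 characteristic splitting, read as in abc-iut-L5-t2's `ArchLocalFrobenioid.tauDash ⊆ O^▷`), an object `M`
  of `𝕋𝕄⊢` (abc-iut-L5-t2's `SplitTopMonoid`), ADMITTING an isomorphism of collections of data to the MODEL triple `ArchDashTriple.model` :=
  (`ArchLocalFrobenioid.ofArchFrd.Cv` = abc-iut-L1-t6's genuine `ArchFrd.Cpt` at `ℂ`, its `O^▷` with `tauDash`, `SplitTopMonoid.ofComplex`) —
  quantified over ALL such triples, not only the model;
* `ArchDashTriple.Iso` — morphisms componentwise (Def 5.2 (iii)): an equivalence `C₁ ⥲ C₂`, a bicontinuous `τ`-compatible `O^▷₁ ≃* O^▷₂`, a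
  `𝕋𝕄⊢`-isomorphism `M₁ ⥲ M₂`; `Iso.toDash` = the projection to the `𝒟⊢`-constituent;
* **`Cor53iii.arch_dashLiftsAll`** — for ANY two triples and EVERY `𝕋𝕄⊢`-isomorphism `g : ¹M ⥲ ²M` there is an isomorphism of triples `f` with
  `f.toDash = g` (the `𝒞⊢`- and `τ`-components come from the two model clauses) — «`Isom(¹𝔉⊢, ²𝔉⊢) → Isom(¹𝔇⊢, ²𝔇⊢)` … is surjective» at arch `v`;
* NON-VACUITY and the DECOUPLING made kernel-visible: `model` inhabits the type (`model_isModel`), and `exists_iso_model_toDash_ne_refl` — an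
  automorphism of the MODEL triple whose `𝕋𝕄⊢`-component is the NON-identity complex conjugation of abc-iut-L5-t13's
  `SplitTopMonoid.exists_hom_ofComplex_ne_refl` while its `𝒞⊢`-component is the identity (print's «isomorphic … not canonically»).
HONEST LABEL (travels with every use): «ARCH `⊢`-slot PRINT-DECOUPLED: the natural map is the projection onto the `𝕋𝕄⊢` constituent; its content is
`Isom_{τ⊢} ≠ ∅`; the [AbsTopIII] Rmk 5.8.1 (i) dilation lift — every `𝕋𝕄⊢`-automorphism of `(O^▷(𝒞⊢_v), τ⊢_v)` induced by a self-equivalence of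
`𝒞⊢_v` — is row R84 (abc-iut-L5-t16 / abc-iut-L1-t6), NOT claimed here».  Binder census of the headline: DATA {T₁, T₂ : ArchDashTriple, g}; LAW ∅ ·
FACT ∅ · side ∅.  typed ≠ inhabited ≠ proved (here: typed AND inhabited AND proved, at print's strength, which is thin); nothing here asserts abc
proved or refuted.
-/

noncomputable section

namespace Literature.IUT.HodgeTheaters

open CategoryTheory

namespace Cor53iii

/-- **An `ℱ⊢`-datum at an archimedean place, VERBATIM [IUTchI] Def 5.2 (ii)(b)**: «a triple of data, consisting of a Frobenioid `‡𝒞⊢_v`, an object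
of `𝕋𝕄⊢`, and a splitting of the Frobenioid, such that there exists an isomorphism of collections of data `‡ℱ⊢_v ⥲ ℱ⊢_v`» — the model `ℱ⊢_v` being
Ex 3.4 (ii)'s `(𝒞⊢_v := 𝒞_v, 𝒟⊢_v, τ⊢_v)` at the GENUINE carrier (`ArchLocalFrobenioid.ofArchFrd`: abc-iut-L1-t6's `ArchFrd.Cpt` over `ℂ`, its
`O^▷` with `tauDash`; abc-iut-L5-t2's `SplitTopMonoid.ofComplex`).  The splitting is read, as in abc-iut-L5-t2's interface, as a submonoid
`τ ⊆ O^▷` of the topological monoid `O^▷(‡𝒞⊢_v)`. ([IUTchI] Def 5.2 (ii) p.134) [claim: Mochizuki2012, status: disputed] -/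
structure ArchDashTriple (C : Type) [Category.{0} C] (OC : Type) [TopologicalSpace OC] [CommMonoid OC] : Type 1 where
  /-- the splitting `‡τ⊢_v ⊆ O^▷(‡𝒞⊢_v)` -/
  tau : Submonoid OC
  /-- the `𝕋𝕄⊢` constituent (= the `𝒟⊢`-prime-strip component at `v`, Def 4.1 (iii)(b)) -/
  M : SplitTopMonoid.{0}
  /-- «such that there exists an isomorphism of collections of data `‡ℱ⊢_v ⥲ ℱ⊢_v`» to the model triple -/
  isModel : Nonempty (C ≌ ArchLocalFrobenioid.ofArchFrd.Cv) ∧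
    (∃ e : OC ≃* ArchLocalFrobenioid.ofArchFrd.OC, Continuous e ∧ Continuous e.symm ∧
      tau.map e.toMonoidHom = ArchLocalFrobenioid.ofArchFrd.tauDash) ∧
    Nonempty (SplitTopMonoid.Hom M SplitTopMonoid.ofComplex)

namespace ArchDashTriple

/-- **THE MODEL TRIPLE `ℱ⊢_v = (𝒞⊢_v, τ⊢_v, 𝒟⊢_v)` at the genuine archimedean carrier** (Ex 3.4 (ii): `𝒞⊢_v := 𝒞_v`, `τ⊢_v` = the preimage of `(0,1]`,
the `𝕋𝕄⊢`-object `(𝒪^▷_ℂ, (0,1])`). ([IUTchI] Ex 3.4 (ii) p.81) [claim: Mochizuki2012, status: disputed] -/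
def model : ArchDashTriple ArchLocalFrobenioid.ofArchFrd.Cv ArchLocalFrobenioid.ofArchFrd.OC where
  tau := ArchLocalFrobenioid.ofArchFrd.tauDash
  M := SplitTopMonoid.ofComplex
  isModel := ⟨⟨CategoryTheory.Equivalence.refl⟩,
    ⟨MulEquiv.refl _, continuous_id, continuous_id, Submonoid.ext fun x =>
      ⟨fun ⟨_, hy, hyx⟩ => hyx ▸ hy, fun hx => ⟨x, hx, rfl⟩⟩⟩,
    SplitTopMonoid.nonempty_hom_ofComplex⟩

/-- The type of archimedean `ℱ⊢`-data over the genuine carriers is inhabited by the model (NON-VACUITY of the slot).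
([IUTchI] Def 5.2 (ii) p.134) [claim: Mochizuki2012, status: disputed] -/
theorem nonempty : Nonempty (ArchDashTriple ArchLocalFrobenioid.ofArchFrd.Cv ArchLocalFrobenioid.ofArchFrd.OC) := ⟨model⟩

variable {C₁ : Type} [Category.{0} C₁] {OC₁ : Type} [TopologicalSpace OC₁] [CommMonoid OC₁]
  {C₂ : Type} [Category.{0} C₂] {OC₂ : Type} [TopologicalSpace OC₂] [CommMonoid OC₂]

/-- **A morphism of archimedean `ℱ⊢`-data, VERBATIM [IUTchI] Def 5.2 (iii)**: «a collection of isomorphisms … between the various constituent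
objects» — an equivalence of the categories, a bicontinuous `τ`-compatible isomorphism of the topological monoids `O^▷`, and a `𝕋𝕄⊢`-isomorphism
of the `𝕋𝕄⊢` constituents. ([IUTchI] Def 5.2 (iii) p.134) [claim: Mochizuki2012, status: disputed] -/
structure Iso (T₁ : ArchDashTriple C₁ OC₁) (T₂ : ArchDashTriple C₂ OC₂) : Type 1 where
  /-- `‡𝒞⊢_v`-component -/
  isoC : C₁ ≌ C₂
  /-- `O^▷`-component -/
  isoOC : OC₁ ≃* OC₂
  /-- continuity -/
  continuous : Continuous isoOC
  /-- continuity of the inverse -/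
  continuous_symm : Continuous isoOC.symm
  /-- `τ`-compatibility -/
  map_tau : T₁.tau.map isoOC.toMonoidHom = T₂.tau
  /-- the `𝕋𝕄⊢`-component (= the induced isomorphism of `𝒟⊢`-constituents).  READING NOTE: `SplitTopMonoid.Hom` IS the morphism type of `𝕋𝕄⊢`
  ([IUTchI] §0 / Ex 3.4 (ii) conventions, abc-iut-L5-t2): a bicontinuous ISOMORPHISM of topological monoids `¹C ⥲ ²C` carrying `¹C→` onto `²C→` —
  every `𝕋𝕄⊢`-morphism is invertible; there are no non-invertible maps in this Hom-type. -/
  isoM : SplitTopMonoid.Hom T₁.M T₂.M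

/-- **«The natural map `Isom(¹𝔉⊢, ²𝔉⊢) → Isom(¹𝔇⊢, ²𝔇⊢)`» at an archimedean index** (Rmk 5.2.1 (i), Def 4.1 (iii)(b)/(iv)): the PROJECTION of an
isomorphism of triples to its `𝕋𝕄⊢`-component.  The codomain `SplitTopMonoid.Hom ¹M ²M` is `Isom_{𝕋𝕄⊢}(¹M, ²M)`: a `𝕋𝕄⊢`-morphism is by definition an
ISOMORPHISM of split topological monoids (bicontinuous `≃*` carrying `C→` onto `C→`), so this map lands in isomorphisms, as on the page.
([IUTchI] Cor 5.3 (iii) p.144) [claim: Mochizuki2012, status: disputed] -/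
def Iso.toDash {T₁ : ArchDashTriple C₁ OC₁} {T₂ : ArchDashTriple C₂ OC₂} (f : Iso T₁ T₂) : SplitTopMonoid.Hom T₁.M T₂.M := f.isoM

/-- Submonoid bookkeeping: if `e` carries `τ₁` onto `σ` and `e'` carries `τ₂` onto `σ`, then `e'⁻¹ ∘ e` carries `τ₁` onto `τ₂`. [folklore] -/
private theorem map_trans_symm_eq {A B D : Type} [CommMonoid A] [CommMonoid B] [CommMonoid D] (e : A ≃* D) (e' : B ≃* D)
    {τ₁ : Submonoid A} {τ₂ : Submonoid B} {σ : Submonoid D} (h₁ : τ₁.map e.toMonoidHom = σ) (h₂ : τ₂.map e'.toMonoidHom = σ) :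
    τ₁.map (e.trans e'.symm).toMonoidHom = τ₂ := by
  ext y
  constructor
  · rintro ⟨x, hx, rfl⟩
    have hex : e x ∈ σ := h₁ ▸ ⟨x, hx, rfl⟩
    rw [← h₂] at hex
    obtain ⟨z, hz, hze⟩ := hex
    have : (e.trans e'.symm).toMonoidHom x = z := by
      change e'.symm (e x) = z
      rw [← hze]; exact e'.symm_apply_apply z
    rw [this]; exact hz
  · intro hy
    have hey : e' y ∈ σ := h₂ ▸ ⟨y, hy, rfl⟩
    rw [← h₁] at hey
    obtain ⟨x, hx, hxe⟩ := hey
    refine ⟨x, hx, ?_⟩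
    change e'.symm (e x) = y
    change e.toMonoidHom x = e' y at hxe
    rw [show e x = e' y from hxe]; exact e'.symm_apply_apply y

end ArchDashTriple

/-- **[IUTchI] Cor 5.3 (iii) AT AN ARCHIMEDEAN INDEX, AS PRINTED: the natural map `Isom(¹𝔉⊢, ²𝔉⊢) → Isom(¹𝔇⊢, ²𝔇⊢)` is SURJECTIVE.**  For ANY two
archimedean `ℱ⊢`-data `T₁, T₂` (triples admitting an iso to the model, Def 5.2 (ii)(b)) and EVERY `𝕋𝕄⊢`-isomorphism `g : ¹M ⥲ ²M` of their
`𝒟⊢`-constituents there is an isomorphism of triples `f : T₁ ⥲ T₂` (Def 5.2 (iii)) with `f.toDash = g`: the `𝒞⊢`- and `(O^▷, τ)`-components are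
`¹(model iso) ∘ ²(model iso)⁻¹`.  Content: `Isom_{τ⊢}(¹𝒞⊢_v, ²𝒞⊢_v) ≠ ∅` — print attaches no datum linking `‡𝒞⊢_v` to the `𝕋𝕄⊢`-object, so the
components extend independently.  LABEL «ARCH `⊢`-slot PRINT-DECOUPLED; the dilation lift of [AbsTopIII] Rmk 5.8.1 (i) is row R84, NOT claimed
here». ([IUTchI] Cor 5.3 (iii) p.144) [claim: Mochizuki2012, status: disputed] -/
theorem arch_dashLiftsAll {C₁ : Type} [Category.{0} C₁] {OC₁ : Type} [TopologicalSpace OC₁] [CommMonoid OC₁]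
    {C₂ : Type} [Category.{0} C₂] {OC₂ : Type} [TopologicalSpace OC₂] [CommMonoid OC₂]
    (T₁ : ArchDashTriple C₁ OC₁) (T₂ : ArchDashTriple C₂ OC₂) (g : SplitTopMonoid.Hom T₁.M T₂.M) :
    ∃ f : ArchDashTriple.Iso T₁ T₂, f.toDash = g := by
  obtain ⟨⟨E₁⟩, ⟨e₁, he₁, he₁', hτ₁⟩, -⟩ := T₁.isModel
  obtain ⟨⟨E₂⟩, ⟨e₂, he₂, he₂', hτ₂⟩, -⟩ := T₂.isModel
  exact ⟨{ isoC := E₁.trans E₂.symm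
           isoOC := e₁.trans e₂.symm
           continuous := he₂'.comp he₁
           continuous_symm := he₁'.comp he₂
           map_tau := ArchDashTriple.map_trans_symm_eq e₁ e₂ hτ₁ hτ₂
           isoM := g }, rfl⟩

/-- **Surjectivity in `Function.Surjective` form** of the projection `Iso T₁ T₂ → Hom_{𝕋𝕄⊢}(¹M, ²M) = Isom_{𝕋𝕄⊢}(¹M, ²M)` (every `𝕋𝕄⊢`-morphism
`SplitTopMonoid.Hom` is an ISOMORPHISM of split topological monoids — this is surjectivity onto `Isom(¹𝔇⊢_v, ²𝔇⊢_v)`, print l.16–19, and no more).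
([IUTchI] Cor 5.3 (iii) p.144) [claim: Mochizuki2012, status: disputed] -/
theorem toDash_surjective {C₁ : Type} [Category.{0} C₁] {OC₁ : Type} [TopologicalSpace OC₁] [CommMonoid OC₁]
    {C₂ : Type} [Category.{0} C₂] {OC₂ : Type} [TopologicalSpace OC₂] [CommMonoid OC₂]
    (T₁ : ArchDashTriple C₁ OC₁) (T₂ : ArchDashTriple C₂ OC₂) :
    Function.Surjective (ArchDashTriple.Iso.toDash : ArchDashTriple.Iso T₁ T₂ → SplitTopMonoid.Hom T₁.M T₂.M) :=
  fun g => arch_dashLiftsAll T₁ T₂ g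

/-- **The decoupling made kernel-visible (NON-VACUITY with a NON-identity `𝒟⊢`-component)**: the MODEL triple has an automorphism whose
`𝕋𝕄⊢`-component is complex conjugation on `(𝒪^▷_ℂ, (0,1])` (abc-iut-L5-t13 `SplitTopMonoid.exists_hom_ofComplex_ne_refl` — NOT the identity) while its
`𝒞⊢`-component is the identity equivalence and its `O^▷`-component the identity: print's «the object `(𝒪^▷(𝒞⊢_v), τ⊢_v)` of `𝕋𝕄⊢` is isomorphic to
`𝒟⊢_v`» — «but not canonically» (Cor 3.9 (ii)). ([IUTchI] Ex 3.4 (ii) p.81) [claim: Mochizuki2012, status: disputed] -/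
theorem exists_iso_model_toDash_ne_refl :
    ∃ f : ArchDashTriple.Iso ArchDashTriple.model ArchDashTriple.model,
      f.toDash.iso ≠ MulEquiv.refl _ ∧ f.isoOC = MulEquiv.refl _ ∧ f.isoC.functor = 𝟭 _ := by
  obtain ⟨c, hc⟩ := SplitTopMonoid.exists_hom_ofComplex_ne_refl
  exact ⟨{ isoC := CategoryTheory.Equivalence.refl
           isoOC := MulEquiv.refl _
           continuous := continuous_id
           continuous_symm := continuous_id
           map_tau := Submonoid.ext fun x => ⟨fun ⟨_, hy, hyx⟩ => hyx ▸ hy, fun hx => ⟨x, hx, rfl⟩⟩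
           isoM := c }, hc, rfl, rfl⟩

end Cor53iii

end Literature.IUT.HodgeTheaters

end
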